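import Literature.NumberTheory.Sieve.FordMaynardPrimeSumsSlices
import Literature.NumberTheory.Sieve.FordMaynardFramework
import Mathlib.Data.Nat.Squarefree
import Mathlib.Data.Fintype.CardEmbedding
import Mathlib.NumberTheory.ArithmeticFunction.Misc
import HarnessLib

/-!
# Ford–Maynard's sequence `w_n = h(𝐯(n)) μ²(n)` and its Type-I sums as prime tuple sums

Fourth file of the arithmetic half of Theorem 6.3 (a) / Theorem 9.1 of K. Ford, J. Maynard,
*On the theory of prime producing sieves* (arXiv:2407.14368). Everything here is PROVED. For a
symmetric function `h` on vectors (`VecFn`), the sequence of §6.2 (wf) is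
`w_n = h(𝐯(n))` for squarefree `n` with prime factors `p₁, …, p_k`,
`𝐯(n) = (log p₁/log n, …, log p_k/log n)` (any order, `h ∈ 𝒮`), and `w_n = 0` otherwise
(`wseq h n`). For a squarefree `m` with `t` prime factors and `R ≤ x/m`, the Type-I sum
`∑_{r ≤ R, x/2 < mr} w_{mr}` ((Smcd) of §6.2) is rewritten EXACTLY as
`∑_{s ≥ 1} (1/s!) ∑_{q}' G_s(log q₁/log x, …, log q_s/log x)`, the inner sum over `s`-tuples of
DISTINCT primes `qᵢ ≤ x` not dividing `m`, with the test functions `G_s = mainG h t s u c₀ c_R` of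
`FordMaynardPrimeSumsSlices.lean` (`Vsum_eq_sum_injective`): squarefree `r` coprime to `m`
correspond to sets of primes, and a set of `s` primes has `s!` enumerations.

* `FordMaynard.wseq` — the sequence; `wseq_eq_of_equiv` — independence of the enumeration;
* `FordMaynard.sum_injective_eq_factorial_mul_sum_powersetCard` — `∑_{q injective} Ψ(im q) = s! ∑_{|S| = s} Ψ(S)`;
* `FordMaynard.Vsum` — the Type-I sum at the divisor `m`; `Vsum_eq_sum_injective` — the identity.

## References

* K. Ford, J. Maynard, *On the theory of prime producing sieves*, arXiv:2407.14368v1 (2024), §6.2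
  (wf), (Smcd). [FordMaynard2024PrimeSieves]
-/

noncomputable section

open MeasureTheory Finset Real

namespace Literature.NumberTheory.Sieve.FordMaynard

/-! ### The sequence -/

/-- An enumeration of the prime factors of `n`. [folklore] -/
def primeEnum (n : ℕ) : Fin n.primeFactors.card → ℕ := fun i => (n.primeFactors.equivFin.symm i : ℕ)

/-- **Ford–Maynard's sequence** `w_n = h(𝐯(n))` for squarefree `n` (with
`𝐯(n) = (log p₁/log n, …, log p_k/log n)` over the prime factors of `n`, in any order since
`h ∈ 𝒮`), and `w_n = 0` for non-squarefree `n`. [cite: FordMaynard2024PrimeSieves, §6.2 (wf)] -/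
def wseq (h : VecFn) (n : ℕ) : ℝ :=
  if Squarefree n then
    h n.primeFactors.card (fun i => Real.log (primeEnum n i) / Real.log n)
  else 0

/-- `w_n = 0` unless `n` is squarefree. [cite: FordMaynard2024PrimeSieves, §6.2 (wf)] -/
theorem wseq_of_not_squarefree (h : VecFn) {n : ℕ} (hn : ¬ Squarefree n) : wseq h n = 0 := by
  unfold wseq; rw [if_neg hn]

/-- **Independence of the enumeration**: for `h ∈ 𝒮`, squarefree `n` and ANY bijection
`e : Fin k ≃ primeFactors n`, `w_n = h(k)((log e(i)/log n)ᵢ)`. [cite: FordMaynard2024PrimeSieves, Definition 6.1] -/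
theorem wseq_eq_of_equiv {h : VecFn} (hsym : h.IsSymmetric) {n : ℕ} (hn : Squarefree n) {k : ℕ}
    (e : Fin k ≃ ↥n.primeFactors) :
    wseq h n = h k (fun i => Real.log ((e i : ℕ)) / Real.log n) := by
  have hk : k = n.primeFactors.card := by
    simpa using Fintype.card_congr e
  subst hk
  unfold wseq
  rw [if_pos hn]
  set e₀ : Fin n.primeFactors.card ≃ ↥n.primeFactors := n.primeFactors.equivFin.symm with he₀
  set σ : Equiv.Perm (Fin n.primeFactors.card) := e.trans e₀.symm with hσ
  have hfun : (fun i => Real.log ((e i : ℕ)) / Real.log n) =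
      (fun i => Real.log (primeEnum n i) / Real.log n) ∘ σ := by
    funext i
    simp only [Function.comp_apply, primeEnum, hσ, Equiv.trans_apply]
    rw [← he₀, Equiv.apply_symm_apply]
  rw [hfun, hsym _ σ]

/-- `w_p = h(1)` on primes. [cite: FordMaynard2024PrimeSieves, §6.2 ("for all primes p ∈ (x/2,x] we have w_p = h(1)")] -/
theorem wseq_prime {h : VecFn} (hsym : h.IsSymmetric) {p : ℕ} (hp : p.Prime) :
    wseq h p = h 1 (fun _ => 1) := by
  have hpf : p.primeFactors = {p} := Nat.Prime.primeFactors hp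
  let e : Fin 1 ≃ ↥p.primeFactors :=
    { toFun := fun _ => ⟨p, by rw [hpf]; exact Finset.mem_singleton_self p⟩
      invFun := fun _ => 0
      left_inv := fun i => by fin_cases i; rfl
      right_inv := fun q => by
        obtain ⟨q, hq⟩ := q
        rw [hpf, Finset.mem_singleton] at hq
        subst hq; rfl }
  rw [wseq_eq_of_equiv hsym hp.squarefree e]
  congr 1
  funext i
  show Real.log (p : ℝ) / Real.log p = 1
  exact div_self (Real.log_pos (by exact_mod_cast hp.one_lt)).ne'

/-! ### Injective tuples versus subsets -/

/-- The injective `s`-tuples with values in `S`, `|S| = s`, number `s!`. [folklore] -/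
theorem card_filter_piFinset_injective (S : Finset ℕ) (s : ℕ) (hS : S.card = s) :
    ((Fintype.piFinset fun _ : Fin s => S).filter (fun q => Function.Injective q)).card =
      s.factorial := by
  classical
  set F := (Fintype.piFinset fun _ : Fin s => S).filter (fun q => Function.Injective q) with hF
  -- an equivalence with the embeddings `Fin s ↪ S`
  have hmem : ∀ q : Fin s → ℕ, q ∈ F ↔ (∀ i, q i ∈ S) ∧ Function.Injective q := by
    intro q; rw [hF, Finset.mem_filter, Fintype.mem_piFinset]
  let E : ↥F ≃ (Fin s ↪ ↥S) :=
    { toFun := fun q => ⟨fun i => ⟨q.1 i, ((hmem q.1).1 q.2).1 i⟩, fun i j hij => by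
        have := ((hmem q.1).1 q.2).2 (congrArg Subtype.val hij); exact this⟩
      invFun := fun f => ⟨fun i => (f i : ℕ), (hmem _).2 ⟨fun i => (f i).2, fun i j hij => by
        exact f.injective (Subtype.ext hij)⟩⟩
      left_inv := fun q => by ext; rfl
      right_inv := fun f => by ext; rfl }
  have h1 : F.card = Fintype.card ↥F := (Fintype.card_coe F).symm
  rw [h1, Fintype.card_congr E, Fintype.card_embedding_eq, Fintype.card_coe, hS, Fintype.card_fin,
    Nat.descFactorial_self]

/-- **Summing over injective tuples**: for `Ψ` a function of finite sets,
`∑_{q : Fin s → Q injective} Ψ(image q) = s! · ∑_{S ⊆ Q, |S| = s} Ψ(S)`. [folklore] -/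
theorem sum_injective_eq_factorial_mul_sum_powersetCard (Q : Finset ℕ) (s : ℕ)
    (Ψ : Finset ℕ → ℝ) :
    ∑ q ∈ (Fintype.piFinset fun _ : Fin s => Q).filter (fun q => Function.Injective q),
        Ψ (Finset.univ.image q) =
      (s.factorial : ℝ) * ∑ S ∈ Q.powersetCard s, Ψ S := by
  classical
  set Inj := (Fintype.piFinset fun _ : Fin s => Q).filter (fun q => Function.Injective q) with hInj
  have hmaps : ∀ q ∈ Inj, Finset.univ.image q ∈ Q.powersetCard s := by
    intro q hq
    rw [hInj, Finset.mem_filter, Fintype.mem_piFinset] at hq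
    rw [Finset.mem_powersetCard]
    refine ⟨fun p hp => ?_, ?_⟩
    · obtain ⟨i, -, rfl⟩ := Finset.mem_image.1 hp; exact hq.1 i
    · rw [Finset.card_image_of_injective _ hq.2, Finset.card_univ, Fintype.card_fin]
  rw [← Finset.sum_fiberwise_of_maps_to hmaps, Finset.mul_sum]
  refine Finset.sum_congr rfl fun S hS => ?_
  rw [Finset.mem_powersetCard] at hS
  -- on the fibre over `S` the summand is constant `Ψ S`
  have hfib : Inj.filter (fun q => Finset.univ.image q = S) =
      (Fintype.piFinset fun _ : Fin s => S).filter (fun q => Function.Injective q) := by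
    ext q
    simp only [hInj, Finset.mem_filter, Fintype.mem_piFinset]
    constructor
    · rintro ⟨⟨-, hinj⟩, himg⟩
      refine ⟨fun i => ?_, hinj⟩
      rw [← himg]; exact Finset.mem_image_of_mem _ (Finset.mem_univ i)
    · rintro ⟨hqS, hinj⟩
      refine ⟨⟨fun i => hS.1 (hqS i), hinj⟩, ?_⟩
      apply Finset.eq_of_subset_of_card_le
      · intro p hp
        obtain ⟨i, -, rfl⟩ := Finset.mem_image.1 hp; exact hqS i
      · rw [Finset.card_image_of_injective _ hinj, Finset.card_univ, Fintype.card_fin, hS.2]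
  rw [Finset.sum_congr rfl (fun q hq => by
    rw [Finset.mem_filter] at hq
    rw [hq.2] : ∀ q ∈ Inj.filter (fun q => Finset.univ.image q = S), Ψ (Finset.univ.image q) = Ψ S),
    Finset.sum_const, hfib, card_filter_piFinset_injective S s hS.2, nsmul_eq_mul]

/-! ### The vector of a squarefree multiple `m r` -/

/-- The logarithmic coordinates `(log pᵢ/log x)ᵢ` of the prime factors of `m`. [folklore] -/
def uvec (x : ℝ) (m : ℕ) : Fin m.primeFactors.card → ℝ := fun i => Real.log (primeEnum m i) / Real.log x

/-- `∑ᵢ log pᵢ = log m` over the prime factors of a squarefree `m`. [folklore] -/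
theorem sum_log_primeEnum {m : ℕ} (hm : Squarefree m) :
    ∑ i, Real.log (primeEnum m i : ℝ) = Real.log m := by
  have h1 : ∑ i, Real.log (primeEnum m i : ℝ) = ∑ p ∈ m.primeFactors, Real.log (p : ℝ) := by
    unfold primeEnum
    rw [Equiv.sum_comp m.primeFactors.equivFin.symm (fun p : ↥m.primeFactors => Real.log ((p : ℕ) : ℝ)),
      Finset.sum_coe_sort m.primeFactors (fun p => Real.log (p : ℝ))]
  rw [h1, ← Real.log_prod, ← Nat.cast_prod, Nat.prod_primeFactors_of_squarefree hm]
  intro p hp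
  exact_mod_cast (Nat.prime_of_mem_primeFactors hp).ne_zero

/-- `∑ uvec = log m / log x`. [folklore] -/
theorem sum_uvec (x : ℝ) {m : ℕ} (hm : Squarefree m) : ∑ i, uvec x m i = Real.log m / Real.log x := by
  unfold uvec
  rw [← Finset.sum_div, sum_log_primeEnum hm]

/-- The entries of `uvec` are nonnegative and `≤ log m/log x` (`x > 1`). [folklore] -/
theorem uvec_nonneg {x : ℝ} (hx : 1 < x) (m : ℕ) (i : Fin m.primeFactors.card) : 0 ≤ uvec x m i := by
  unfold uvec primeEnum
  refine div_nonneg (Real.log_nonneg ?_) (Real.log_pos hx).le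
  have := (m.primeFactors.equivFin.symm i).2
  exact_mod_cast (Nat.prime_of_mem_primeFactors this).one_lt.le

/-- A product of distinct primes is squarefree. [folklore] -/
theorem squarefree_prod_of_primes (S : Finset ℕ) (hS : ∀ p ∈ S, p.Prime) :
    Squarefree (∏ p ∈ S, p) := by
  classical
  induction S using Finset.induction_on with
  | empty => simp
  | insert p S hp ih =>
    rw [Finset.prod_insert hp, Nat.squarefree_mul_iff]
    have hpP : p.Prime := hS p (Finset.mem_insert_self p S)
    have hS' : ∀ q ∈ S, q.Prime := fun q hq => hS q (Finset.mem_insert_of_mem hq)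
    refine ⟨Nat.Coprime.prod_right fun q hq => (Nat.coprime_primes hpP (hS' q hq)).2 ?_, hpP.squarefree,
      ih hS'⟩
    rintro rfl; exact hp hq

/-- **The vector of `m · q₁ ⋯ q_s`.** For `h ∈ 𝒮`, squarefree `m` and distinct primes `qᵢ ∤ m`,
`w_{m q₁⋯q_s} = h(t+s)((u, y)/(λ + |y|))` with `u = uvec x m`, `y = (log qᵢ/log x)`: the vector
`𝐯(mr)` is, up to order, `(log p₁, …, log p_t, log q₁, …, log q_s)/log(mr)`.
[cite: FordMaynard2024PrimeSieves, §6.2 (Smcd)] -/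
theorem wseq_mul_prod_eq {h : VecFn} (hsym : h.IsSymmetric) {x : ℝ} (hx : 1 < x) {m : ℕ}
    (hm : Squarefree m) {s : ℕ} {q : Fin s → ℕ} (hq : Function.Injective q)
    (hqP : ∀ i, (q i).Prime) (hqm : ∀ i, q i ∉ m.primeFactors) :
    wseq h (m * ∏ i, q i) = h (m.primeFactors.card + s) (normVec (uvec x m) (logVec x q)) := by
  classical
  set t := m.primeFactors.card with ht
  set T := m.primeFactors with hT
  set S : Finset ℕ := Finset.univ.image q with hSdef
  set r : ℕ := ∏ i, q i with hr
  have hm0 : m ≠ 0 := hm.ne_zero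
  have hL : 0 < Real.log x := Real.log_pos hx
  -- `r` as a product over the set `S`
  have hrS : r = ∏ p ∈ S, p := by
    rw [hSdef, Finset.prod_image fun i _ j _ hij => hq hij]
  have hSP : ∀ p ∈ S, p.Prime := by
    intro p hp; rw [hSdef, Finset.mem_image] at hp
    obtain ⟨i, -, rfl⟩ := hp; exact hqP i
  have hrsq : Squarefree r := by rw [hrS]; exact squarefree_prod_of_primes S hSP
  have hr0 : r ≠ 0 := hrsq.ne_zero
  have hrpf : r.primeFactors = S := by rw [hrS]; exact Nat.primeFactors_prod hSP
  have hcop : Nat.Coprime m r := by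
    rw [hr]
    refine Nat.Coprime.prod_right fun i _ => ?_
    have hndvd : ¬ q i ∣ m := fun hd => hqm i (Nat.mem_primeFactors.2 ⟨hqP i, hd, hm0⟩)
    exact ((Nat.Prime.coprime_iff_not_dvd (hqP i)).2 hndvd).symm
  have hsq : Squarefree (m * r) := Nat.squarefree_mul_iff.2 ⟨hcop, hm, hrsq⟩
  have hpf : (m * r).primeFactors = T ∪ S := by rw [Nat.primeFactors_mul hm0 hr0, hrpf]
  have hdisj : Disjoint T S := by rw [hT, ← hrpf]; exact hcop.disjoint_primeFactors
  -- the enumeration of the prime factors of `m r`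
  let eT : Fin t ≃ ↥T := T.equivFin.symm
  have hqS : ∀ i, q i ∈ S := fun i => by rw [hSdef]; exact Finset.mem_image_of_mem _ (Finset.mem_univ i)
  let eS : Fin s ≃ ↥S := Equiv.ofBijective (fun i => ⟨q i, hqS i⟩)
    ⟨fun i j hij => hq (congrArg Subtype.val hij), fun p => by
      obtain ⟨p, hp⟩ := p
      rw [hSdef, Finset.mem_image] at hp
      obtain ⟨i, -, rfl⟩ := hp
      exact ⟨i, rfl⟩⟩
  let E : Fin (t + s) ≃ ↥(m * r).primeFactors :=
    finSumFinEquiv.symm.trans ((Equiv.sumCongr eT eS).trans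
      ((Equiv.Finset.union T S hdisj).trans (Equiv.subtypeEquivRight (fun p => by rw [hpf]))))
  have hEl : ∀ j : Fin t, ((E (Fin.castAdd s j) : ℕ) : ℝ) = primeEnum m j := by
    intro j
    simp only [E, Equiv.trans_apply, finSumFinEquiv_symm_apply_castAdd, Equiv.sumCongr_apply,
      Sum.map_inl, Equiv.Finset.union, Equiv.subtypeEquivRight]
    rfl
  have hEr : ∀ j : Fin s, ((E (Fin.natAdd t j) : ℕ) : ℝ) = q j := by
    intro j
    simp only [E, Equiv.trans_apply, finSumFinEquiv_symm_apply_natAdd, Equiv.sumCongr_apply,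
      Sum.map_inr, Equiv.Finset.union, Equiv.subtypeEquivRight]
    rfl
  rw [show m * ∏ i, q i = m * r from rfl, wseq_eq_of_equiv hsym hsq E]
  congr 1
  funext i
  -- the normalising denominators: `λ + |y| = log(mr)/log x`
  have hsum_u : ∑ j, uvec x m j = Real.log m / Real.log x := sum_uvec x hm
  have hsum_y : ∑ j, logVec x q j = Real.log r / Real.log x := by
    unfold logVec
    rw [← Finset.sum_div, ← Real.log_prod, hr, Nat.cast_prod]
    intro i _; exact_mod_cast (hqP i).ne_zero
  have hden : (∑ j, uvec x m j) + ∑ j, logVec x q j = Real.log ((m * r : ℕ)) / Real.log x := by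
    rw [hsum_u, hsum_y, ← add_div, Nat.cast_mul, Real.log_mul (by exact_mod_cast hm0)
      (by exact_mod_cast hr0)]
  refine Fin.addCases (fun j => ?_) (fun j => ?_) i
  · rw [hEl]
    unfold normVec
    rw [Fin.append_left, hden]
    unfold uvec
    rw [div_div_div_cancel_right₀ hL.ne']
  · rw [hEr]
    unfold normVec
    rw [Fin.append_right, hden]
    unfold logVec
    rw [div_div_div_cancel_right₀ hL.ne']

/-! ### The Type-I sum at a divisor `m` as a sum over injective prime tuples -/

/-- The Type-I sum at the divisor `m` up to `R`: `∑_{1 ≤ r ≤ R, x/2 < mr} w_{mr}`.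
[cite: FordMaynard2024PrimeSieves, §6.2 (Smcd)] -/
def Vsum (h : VecFn) (x : ℝ) (m R : ℕ) : ℝ :=
  ∑ r ∈ (Finset.Icc 1 R).filter (fun r : ℕ => x / 2 < ((m * r : ℕ) : ℝ)), wseq h (m * r)

/-- The test-function sum over injective `s`-tuples of primes avoiding the prime factors of `m`.
[cite: FordMaynard2024PrimeSieves, §6.2 (Smcd)] -/
def injSum (h : VecFn) (x : ℝ) (m R s : ℕ) : ℝ :=
  ∑ q ∈ (Fintype.piFinset fun _ : Fin s => Nat.primesLE ⌊x⌋₊).filter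
      (fun q => Function.Injective q ∧ ∀ i, q i ∉ m.primeFactors),
    mainG h m.primeFactors.card s (uvec x m) (Real.log (x / (2 * m)) / Real.log x)
      (Real.log R / Real.log x) (logVec x q)

/-- The range conditions in logarithmic coordinates. [folklore] -/
theorem range_iff {x : ℝ} (hx : 1 < x) {m : ℕ} (hm : 1 ≤ m) (R : ℕ) {s : ℕ} {q : Fin s → ℕ}
    (hq : ∀ i, (q i).Prime) (hs : 1 ≤ s) :
    ((∏ i, q i) ≤ R ∧ x / 2 < (m * ∏ i, q i : ℕ)) ↔
      (Real.log (x / (2 * m)) / Real.log x < ∑ i, logVec x q i ∧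
        ∑ i, logVec x q i ≤ Real.log R / Real.log x) := by
  have hL : 0 < Real.log x := Real.log_pos hx
  have hx0 : 0 < x := by linarith
  have hm0 : (0 : ℝ) < m := by exact_mod_cast hm
  have hr2 : 2 ≤ ∏ i, q i := by
    obtain ⟨i⟩ : Nonempty (Fin s) := ⟨⟨0, hs⟩⟩
    calc 2 ≤ q i := (hq i).two_le
      _ ≤ ∏ j, q j := Nat.le_of_dvd (Finset.prod_pos fun j _ => (hq j).pos)
          (Finset.dvd_prod_of_mem _ (Finset.mem_univ i))
  have hr0 : (0 : ℝ) < ∏ i, q i := by exact_mod_cast lt_of_lt_of_le (by norm_num) hr2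
  have hsum : ∑ i, logVec x q i = Real.log (∏ i, q i : ℕ) / Real.log x := by
    unfold logVec
    rw [← Finset.sum_div, ← Real.log_prod, Nat.cast_prod]
    intro i _; exact_mod_cast (hq i).ne_zero
  rw [hsum, div_lt_div_iff_of_pos_right hL, div_le_div_iff_of_pos_right hL, and_comm]
  refine and_congr ?_ ?_
  · rw [Real.log_lt_log_iff (by positivity) hr0, Nat.cast_mul,
      div_lt_iff₀ (by positivity : (0:ℝ) < 2 * m)]
    constructor <;> intro h <;> linarith
  · rcases Nat.eq_zero_or_pos R with hR | hR
    · subst hR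
      simp only [Nat.cast_zero, Real.log_zero, nonpos_iff_eq_zero]
      constructor
      · intro h; exact absurd h (by positivity)
      · intro h
        have : Real.log (∏ i, q i : ℕ) > 0 := Real.log_pos (by exact_mod_cast lt_of_lt_of_le (by norm_num) hr2)
        linarith
    · rw [Real.log_le_log_iff hr0 (by exact_mod_cast hR), Nat.cast_le]

/-- **The Type-I sum at `m` as sums over injective prime tuples** (the combinatorial heart of
(Smcd), §6.2): for `h ∈ 𝒮` vanishing in dimensions `> K_max`, squarefree `m ≤ x/2`, `R ≤ x/m`
and `S_max ≥ K_max`,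
`∑_{r ≤ R, x/2 < mr} w_{mr} = ∑_{s=1}^{S_max} (1/s!) ∑_{q₁,…,q_s distinct primes ≤ x, qᵢ ∤ m}`
`  h(t+s)((u, y(q))/(λ + |y(q)|)) 𝟙(x/2 < m q₁⋯q_s ≤ mR)`.
[cite: FordMaynard2024PrimeSieves, §6.2 (Smcd)] -/
theorem Vsum_eq_sum_injSum {h : VecFn} (hsym : h.IsSymmetric) {Kmax : ℕ}
    (hvan : ∀ k, Kmax < k → ∀ v, h k v = 0) {x : ℝ} (hx : 1 < x) {m : ℕ} (hm : Squarefree m)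
    (hmx : (m : ℝ) ≤ x / 2) {R : ℕ} (hR : (R : ℝ) ≤ x / m) {Smax : ℕ} (hS : Kmax ≤ Smax) :
    Vsum h x m R = ∑ s ∈ Finset.Icc 1 Smax, (1 / (s.factorial : ℝ)) * injSum h x m R s := by
  classical
  have hx0 : 0 < x := by linarith
  have hm0 : m ≠ 0 := hm.ne_zero
  have hm1 : 1 ≤ m := Nat.one_le_iff_ne_zero.2 hm0
  have hmR : (0 : ℝ) < m := by exact_mod_cast hm1
  set P : Finset ℕ := Nat.primesLE ⌊x⌋₊ with hP
  set T : Finset ℕ := m.primeFactors with hT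
  set t : ℕ := T.card with ht
  set Q : Finset ℕ := P \ T with hQ
  set F : Finset ℕ := (Finset.Icc 1 R).filter (fun r : ℕ => x / 2 < ((m * r : ℕ) : ℝ)) with hF
  set Φ : Finset ℕ → ℝ := fun S => wseq h (m * ∏ p ∈ S, p) with hΦ
  set conds : Finset ℕ → Prop := fun S => (∏ p ∈ S, p) ≤ R ∧ x / 2 < ((m * ∏ p ∈ S, p : ℕ) : ℝ)
    with hconds
  set SS : Finset (Finset ℕ) := Q.powerset.filter conds with hSS
  -- primes of an element of `Q` do not divide `m`
  have hQ_prime : ∀ p ∈ Q, p.Prime := fun p hp => by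
    rw [hQ, Finset.mem_sdiff, hP, Nat.mem_primesLE] at hp; exact hp.1.2
  have hQ_cop : ∀ p ∈ Q, Nat.Coprime m p := by
    intro p hp
    have hp' := hp
    rw [hQ, Finset.mem_sdiff] at hp'
    have hndvd : ¬ p ∣ m := fun hd => hp'.2 (by rw [hT]; exact Nat.mem_primeFactors.2 ⟨hQ_prime p hp, hd, hm0⟩)
    exact ((Nat.Prime.coprime_iff_not_dvd (hQ_prime p hp)).2 hndvd).symm
  ------------------------------------------------------------------
  -- Step a: only squarefree `m r` contribute
  ------------------------------------------------------------------
  have ha : Vsum h x m R = ∑ r ∈ F.filter (fun r => Squarefree (m * r)), wseq h (m * r) := by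
    rw [Finset.sum_filter_of_ne]
    · rfl
    · intro r _ hne
      by_contra hsq
      exact hne (wseq_of_not_squarefree h hsq)
  ------------------------------------------------------------------
  -- Step b: reindex by the set of prime factors of `r`
  ------------------------------------------------------------------
  have hb : ∑ r ∈ F.filter (fun r => Squarefree (m * r)), wseq h (m * r) = ∑ S ∈ SS, Φ S := by
    refine Finset.sum_nbij' (fun r => r.primeFactors) (fun S => ∏ p ∈ S, p) ?_ ?_ ?_ ?_ ?_
    · -- `r ↦ primeFactors r` lands in `SS`
      intro r hr
      rw [Finset.mem_filter, hF, Finset.mem_filter, Finset.mem_Icc] at hr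
      obtain ⟨⟨⟨hr1, hrR⟩, hxr⟩, hsq⟩ := hr
      obtain ⟨hcop, -, hrsq⟩ := Nat.squarefree_mul_iff.1 hsq
      rw [hSS, Finset.mem_filter, Finset.mem_powerset]
      refine ⟨fun p hp => ?_, ?_⟩
      · have hp' := Nat.mem_primeFactors.1 hp
        rw [hQ, Finset.mem_sdiff, hP, Nat.mem_primesLE]
        refine ⟨⟨?_, hp'.1⟩, fun hpT => ?_⟩
        · rw [Nat.le_floor_iff hx0.le]
          have hpr : (p : ℝ) ≤ r := by exact_mod_cast Nat.le_of_dvd hr1 hp'.2.1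
          have hrx : (r : ℝ) ≤ x := by
            calc (r : ℝ) ≤ R := by exact_mod_cast hrR
              _ ≤ x / m := hR
              _ ≤ x := div_le_self hx0.le (by exact_mod_cast hm1)
          linarith
        · exact Finset.disjoint_left.1 hcop.disjoint_primeFactors (by rw [hT] at hpT; exact hpT) hp
      · show (∏ p ∈ r.primeFactors, p) ≤ R ∧ x / 2 < ((m * ∏ p ∈ r.primeFactors, p : ℕ) : ℝ)
        rw [Nat.prod_primeFactors_of_squarefree hrsq]
        exact ⟨hrR, hxr⟩
    · -- `S ↦ ∏ S` lands in the squarefree part of `F`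
      intro S hSS'
      rw [hSS, Finset.mem_filter, Finset.mem_powerset] at hSS'
      obtain ⟨hSQ, hle, hgt⟩ := hSS'
      have hprime : ∀ p ∈ S, p.Prime := fun p hp => hQ_prime p (hSQ hp)
      rw [Finset.mem_filter, hF, Finset.mem_filter, Finset.mem_Icc]
      refine ⟨⟨⟨Nat.one_le_iff_ne_zero.2 (Finset.prod_ne_zero_iff.2 fun p hp => (hprime p hp).ne_zero),
        hle⟩, hgt⟩, ?_⟩
      exact Nat.squarefree_mul_iff.2 ⟨Nat.Coprime.prod_right fun p hp => hQ_cop p (hSQ hp), hm,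
        squarefree_prod_of_primes S hprime⟩
    · intro r hr
      rw [Finset.mem_filter] at hr
      exact Nat.prod_primeFactors_of_squarefree (Nat.squarefree_mul_iff.1 hr.2).2.2
    · intro S hSS'
      rw [hSS, Finset.mem_filter, Finset.mem_powerset] at hSS'
      exact Nat.primeFactors_prod fun p hp => hQ_prime p (hSS'.1 hp)
    · intro r hr
      rw [Finset.mem_filter] at hr
      show wseq h (m * r) = wseq h (m * ∏ p ∈ r.primeFactors, p)
      rw [Nat.prod_primeFactors_of_squarefree (Nat.squarefree_mul_iff.1 hr.2).2.2]
  ------------------------------------------------------------------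
  -- Step c: group by the cardinality `s = |S|`, `1 ≤ s ≤ Smax`
  ------------------------------------------------------------------
  have hΦ0 : ∀ S ∈ SS, Smax < S.card → Φ S = 0 := by
    intro S hSS' hcard
    rw [hSS, Finset.mem_filter, Finset.mem_powerset] at hSS'
    have hprime : ∀ p ∈ S, p.Prime := fun p hp => hQ_prime p (hSS'.1 hp)
    show wseq h (m * ∏ p ∈ S, p) = 0
    by_cases hsq : Squarefree (m * ∏ p ∈ S, p)
    · unfold wseq
      rw [if_pos hsq]
      apply hvan
      have hr0 : (∏ p ∈ S, p) ≠ 0 := Finset.prod_ne_zero_iff.2 fun p hp => (hprime p hp).ne_zero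
      rw [Nat.primeFactors_mul hm0 hr0, Nat.primeFactors_prod hprime,
        Finset.card_union_of_disjoint]
      · omega
      · have hcop : Nat.Coprime m (∏ p ∈ S, p) := (Nat.squarefree_mul_iff.1 hsq).1
        have := hcop.disjoint_primeFactors
        rwa [Nat.primeFactors_prod hprime] at this
    · exact wseq_of_not_squarefree h hsq
  have hempty : ∀ S ∈ SS, S.card ≠ 0 := by
    intro S hSS' hcard
    rw [Finset.card_eq_zero] at hcard
    subst hcard
    rw [hSS, Finset.mem_filter] at hSS'
    have := hSS'.2.2
    simp only [Finset.prod_empty, mul_one] at this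
    linarith
  have hc : ∑ S ∈ SS, Φ S = ∑ s ∈ Finset.Icc 1 Smax, ∑ S ∈ SS.filter (fun S => S.card = s), Φ S := by
    have key : ∀ S ∈ SS, Φ S = ∑ s ∈ Finset.Icc 1 Smax, if S.card = s then Φ S else 0 := by
      intro S hSS'
      by_cases hcs : S.card ∈ Finset.Icc 1 Smax
      · rw [Finset.sum_ite_eq (Finset.Icc 1 Smax) S.card (fun _ => Φ S), if_pos hcs]
      · rw [Finset.sum_eq_zero (fun s hs => if_neg (fun hc' => hcs (by rw [hc']; exact hs)))]
        rw [Finset.mem_Icc, not_and_or, not_le, not_le] at hcs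
        rcases hcs with h1 | h2
        · exact absurd (Nat.lt_one_iff.1 h1) (hempty S hSS')
        · exact hΦ0 S hSS' h2
    rw [Finset.sum_congr rfl key, Finset.sum_comm]
    refine Finset.sum_congr rfl fun s _ => ?_
    exact (Finset.sum_filter _ _).symm
  ------------------------------------------------------------------
  -- Step d/e: for each `s`, subsets of size `s` versus injective tuples
  ------------------------------------------------------------------
  have hde : ∀ s ∈ Finset.Icc 1 Smax, ∑ S ∈ SS.filter (fun S => S.card = s), Φ S =
      (1 / (s.factorial : ℝ)) * injSum h x m R s := by
    intro s hs
    rw [Finset.mem_Icc] at hs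
    set Ψ : Finset ℕ → ℝ := fun S => if conds S then Φ S else 0 with hΨ
    -- subsets of size `s`
    have hd1 : ∑ S ∈ SS.filter (fun S => S.card = s), Φ S = ∑ S ∈ Q.powersetCard s, Ψ S := by
      rw [hΨ, Finset.sum_ite, Finset.sum_const_zero, add_zero]
      refine Finset.sum_congr ?_ fun _ _ => rfl
      ext S
      simp only [hSS, Finset.mem_filter, Finset.mem_powerset, Finset.mem_powersetCard]
      tauto
    -- injective tuples
    have hd2 := sum_injective_eq_factorial_mul_sum_powersetCard Q s Ψ
    have hfact : (s.factorial : ℝ) ≠ 0 := by positivity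
    have hd3 : ∑ S ∈ Q.powersetCard s, Ψ S = (1 / (s.factorial : ℝ)) *
        ∑ q ∈ (Fintype.piFinset fun _ : Fin s => Q).filter (fun q => Function.Injective q),
          Ψ (Finset.univ.image q) := by
      rw [hd2]; field_simp
    rw [hd1, hd3]
    congr 1
    -- identify with `injSum`
    unfold injSum
    refine Finset.sum_congr ?_ ?_
    · ext q
      simp only [Finset.mem_filter, Fintype.mem_piFinset, hQ, Finset.mem_sdiff]
      constructor
      · rintro ⟨hq, hinj⟩; exact ⟨fun i => (hq i).1, hinj, fun i => (hq i).2⟩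
      · rintro ⟨hq, hinj, hqT⟩; exact ⟨fun i => ⟨hq i, hqT i⟩, hinj⟩
    · intro q hq
      rw [Finset.mem_filter, Fintype.mem_piFinset] at hq
      obtain ⟨hqP', hinj, hqT⟩ := hq
      have hqQ : ∀ i, q i ∈ Q := fun i => by rw [hQ, Finset.mem_sdiff]; exact ⟨hqP' i, hqT i⟩
      have hqP : ∀ i, (q i).Prime := fun i => hQ_prime _ (hqQ i)
      have hprodimg : ∏ p ∈ Finset.univ.image q, p = ∏ i, q i :=
        Finset.prod_image fun i _ j _ hij => hinj hij
      show (if conds (Finset.univ.image q) then Φ (Finset.univ.image q) else 0) =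
        mainG h m.primeFactors.card s (uvec x m) (Real.log (x / (2 * m)) / Real.log x)
          (Real.log R / Real.log x) (logVec x q)
      unfold mainG
      have hiff : conds (Finset.univ.image q) ↔
          (Real.log (x / (2 * m)) / Real.log x < ∑ i, logVec x q i ∧
            ∑ i, logVec x q i ≤ Real.log R / Real.log x) := by
        rw [hconds]; simp only []
        rw [hprodimg]
        exact range_iff hx hm1 R hqP hs.1
      by_cases hcq : conds (Finset.univ.image q)
      · rw [if_pos hcq, if_pos (hiff.1 hcq)]
        show wseq h (m * ∏ p ∈ Finset.univ.image q, p) = _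
        rw [hprodimg, wseq_mul_prod_eq hsym hx hm hinj hqP hqT]
      · rw [if_neg hcq, if_neg (fun h => hcq (hiff.2 h))]
  rw [ha, hb, hc]
  exact Finset.sum_congr rfl hde

end Literature.NumberTheory.Sieve.FordMaynard
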